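import Summits.ABC.ABC.Theses.CubicResolventAllowance
import Summits.ABC.ABC.Theorems.CubicResolventAllowanceResolventDiscBounds
import Summits.ABC.ABC.Theorems.NumberFieldRamificationDiscr
import Literature.NumberTheory.EllipticCurves.DivisionFieldSelfRamificationProofs
import Literature.NumberTheory.EllipticCurves.BurungaleCastellaSkinner2025.VexingPrimesMultiplicativeProofs
import Literature.NumberTheory.NumberFields.RelativeDifferentExponentsTower
import HarnessLib

/-!
# STUB-IDEAS `stub_realCubic` · ideator k3 · generation 8 — THE EXTREME OF THE ALLOWANCE

Crux stmt-ABC-22740 `CubicResolventAllowance.IndexSzpiro`, stub `stub_realCubic` (the `d_K > 0` half),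
route-ABC-CubicResolventAllowance.  HOME FAMILY 3 (probe the extremes), gen 8: the one extreme the seven
earlier k3 pages did not probe is the extreme of the ALLOWANCE `|d_K|` itself.  Prime by prime:

* odd multiplicative `p` (`f_p = 1`): every prime of `ℚ(E[2])` over `p` has `e ∣ 2` (Tate curve, tree
  `ramificationIdx_divisionField_self_dvd_level_of_hasMultiplicativeReductionAt` at level `n = 2`), hence
  (tower, `Ideal.ramificationIdx_below_le`) every prime of the cubic `K ↪ ℚ(E[2])` has `e ≤ 2`, tame, so
  `v_p(d_K) ≤ 1 = f_p` (H1+H2); with the keystone parity `2⁸Δ_min = I²d_K` (k1 G5 `K6`, PROVED in this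
  directory) `v_p(d_K) = n_p mod 2` EXACTLY (H6);
* additive `p ≥ 5`: `v_p(d_K) ≤ 2 = f_p` (tree cap); `p = 3`: `≤ 1` if `f_3 = 1` (H1+H2), `≤ 5 ≤ 3+f_3` if
  `f_3 ≥ 2` (tree cap); `p = 2`: `≤ 3` (tree cap).
Hence `|d_K| ∣ 216·N` (H3, provable NOW; the landed support `ResolventDiscBounds` has `1944·N²`), so the
stub sits in the class-Szpiro window `6+ε ⇐ stub ⇐ 7+ε` (H5; k1 g9 had `⇐ 8+ε`).  Numerically (kit job
j344906, census of > 10⁶ curves): `|d_K| ≤ 4·N` always, attained (`v_2(d_K) ≤ f_2+2`, `v_3(d_K) ≤ f_3`,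
`v_p(d_K) = κ(Kodaira) ∈ {0,1,2}` at additive `p ≥ 5`) — H7, stated, NOT to be staffed (needs tame/Swan input
absent from the tree).  No helper here implies the stub: its kernel is `OddTowerSzpiro` (k2 g4, OPEN,
Szpiro-strength); the verdict of gens 1–7 (open-problem) stands and this page makes it quantitative.
Sorries: exactly the helper bodies marked below; the bookkeeping implications are proved.
-/

noncomputable section

open scoped NumberField
open NumberField IsDedekindDomain Ideal Polynomial WeierstrassCurve

namespace Summit.ABC.ABC.Cruxes.IndexSzpiro.StubIdeas3G8

open Summit.ABC.ABC.Theses.CubicResolventAllowance Summit.ABC.ABC.Theorems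

/-- The registered stub `stub_realCubic`, verbatim. -/
def StubRealCubic : Prop :=
  ∀ ε : ℝ, 0 < ε → ∃ C : ℝ, ∀ (W : WeierstrassCurve ℚ) [W.IsElliptic] (K : Type) [Field K] [NumberField K],
    Irreducible W.twoTorsionPolynomial.toPoly → Module.finrank ℚ K = 3 →
    (∃ θ : K, aeval θ W.twoTorsionPolynomial.toPoly = 0) → 0 < NumberField.discr K →
    (W.minimalDiscriminantNorm ℤ : ℝ) ≤ C * |(NumberField.discr K : ℝ)| * (W.conductorNorm ℤ : ℝ) ^ (6 + ε)

/-- Class-restricted Szpiro with exponent `κ` on the stub's class (irreducible 2-division cubic, a cubic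
field with a root, `d_K > 0`, i.e. `Δ > 0`). `κ = 6`: Szpiro on the class; every `κ` is OPEN. -/
def ClassSzpiroReal (κ : ℝ) : Prop :=
  ∀ ε : ℝ, 0 < ε → ∃ C : ℝ, ∀ (W : WeierstrassCurve ℚ) [W.IsElliptic] (K : Type) [Field K] [NumberField K],
    Irreducible W.twoTorsionPolynomial.toPoly → Module.finrank ℚ K = 3 →
    (∃ θ : K, aeval θ W.twoTorsionPolynomial.toPoly = 0) → 0 < NumberField.discr K →
    (W.minimalDiscriminantNorm ℤ : ℝ) ≤ C * (W.conductorNorm ℤ : ℝ) ^ (κ + ε)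

/-! ## H1 (S/M, pure ANT) — a cubic field whose primes over an odd `p` all have `e ≤ 2` has `v_p(d_K) ≤ 1` -/

/-- **H1.** `[K:ℚ] = 3`, `p` odd, every `P | p` with `e(P|p) ≤ 2` ⇒ `v_p(d_K) ≤ 1`.
Proof plan (all in `CubicResolventAllowanceResolventDiscBoundsCaps`): `padicValNat_discr_le_sum`;
each `P` is tame (`e ≤ 2 < p`, `multiplicity_differentIdeal_int_eq_of_not_dvd` ⇒ `ord_P 𝔇 = e-1`);
`∑ e f = 3` (`sum_ramificationIdx_mul_inertiaDeg`) with all `e ≤ 2` forces `∑ (e-1) f ≤ 1`.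
[cite: NeukirchANT1999, Ch. III (2.6)] -/
theorem padicValNat_discr_le_one_of_ramificationIdx_le_two (K : Type*) [Field K] [NumberField K]
    (hK : Module.finrank ℚ K = 3) {p : ℕ} (hp : p.Prime) (hp2 : p ≠ 2)
    (h : ∀ P ∈ IsDedekindDomain.primesOverFinset (Ideal.span {(p : ℤ)}) (𝓞 K), P.ramificationIdx ℤ ≤ 2) :
    padicValNat p (NumberField.discr K).natAbs ≤ 1 := by
  sorry

/-! ## H2 (S/M, the elliptic input at level 2) — odd multiplicative `p` ⇒ every prime of `K` over `p` has `e ≤ 2` -/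

/-- **H2.** If `K` embeds in `ℚ(E[2])` and `f_p(E) = 1` at an odd prime `p`, every prime `P` of `𝓞 K`
over `p` has `e(P|p) ≤ 2`.  Proof plan: `f_p = 1 ⇒` multiplicative reduction at the place of `𝓞 ℚ` over
`p` (`BurungaleCastellaSkinner2025.hasMultiplicativeReductionAt_ringOfIntegers_of_factorization_conductorNorm_eq_one`);
`(2 : 𝓞 ℚ) ∉ v` (`p ≠ 2`); every `Q | v` of `𝓞 ℚ(E[2])` has `e(Q|𝓞 ℚ) ∣ 2`
(`ramificationIdx_divisionField_self_dvd_level_of_hasMultiplicativeReductionAt`, `n = 2`) and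
`e(Q|𝓞 ℚ) = e(Q|ℤ)` (`ramificationIdx_ringOfIntegers_rat_eq`); pick `Q` over `P`
(`Ideal.exists_maximal_ideal_liesOver_of_isIntegral`, with `ψ.toAlgebra`) and descend with
`Ideal.ramificationIdx_below_le` / `ramificationIdx_int_eq_mul`.
[cite: SilvermanATAEC1994, V.4–V.5 and Exercise 5.13 (b)] -/
theorem ramificationIdx_le_two_of_factorization_conductorNorm_eq_one (W : WeierstrassCurve ℚ) [W.IsElliptic]
    (K : Type*) [Field K] [NumberField K] (ψ : K →+* W.divisionField 2)
    {p : ℕ} (hp : p.Prime) (hp2 : p ≠ 2) (hf : (W.conductorNorm ℤ).factorization p = 1) :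
    ∀ P ∈ IsDedekindDomain.primesOverFinset (Ideal.span {(p : ℤ)}) (𝓞 K), P.ramificationIdx ℤ ≤ 2 := by
  sorry

/-! ## H3 (M, the bankable file) — the SHARPENED allowance `|d_K| ∣ 216·N` (landed: `1944·N²`) -/

/-- **H3.** `|d_K| ∣ 2³·3³·N`.  Template = landed `natAbs_discr_dvd_of_cubic` (prime by prime via
`Nat.factorization_prime_le_iff_dvd`); new branches: `f_p = 1`, `p` odd ⇒ `v_p(d_K) ≤ 1` (H2 then H1);
`f_p ≥ 2` ⇒ caps `v_p ≤ 2` (`p ≥ 5`, `padicValNat_discr_le_of_finrank_lt`), `v₃ ≤ 5 ≤ 3 + f₃`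
(`padicValNat_three_discr_le_five`); `v₂ ≤ 3` (`padicValNat_two_discr_le_three`); `f_p = 0`, `p` odd ⇒ `0`
(`not_dvd_discr_divisionField_two` + `NumberField.discr_dvd_discr`). [cite: SilvermanAEC2009, Thm. VII.7.1] -/
theorem natAbs_discr_dvd_216_mul_conductorNorm (W : WeierstrassCurve ℚ) [W.IsElliptic]
    (K : Type*) [Field K] [NumberField K] (hK : Module.finrank ℚ K = 3) (ψ : K →+* W.divisionField 2) :
    (NumberField.discr K).natAbs ∣ 216 * W.conductorNorm ℤ := by
  sorry

/-- **H3 on the stub's binders** (S from H3: `K = ℚ(θ)` embeds in `ℚ(E[2])`, exactly as in the landed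
`resolventDiscBounds_proof`). -/
theorem natAbs_discr_dvd_216_mul_conductorNorm_of_root (W : WeierstrassCurve ℚ) [W.IsElliptic]
    (K : Type*) [Field K] [NumberField K] (hirr : Irreducible W.twoTorsionPolynomial.toPoly)
    (hK : Module.finrank ℚ K = 3) (hθ : ∃ θ : K, aeval θ W.twoTorsionPolynomial.toPoly = 0) :
    (NumberField.discr K).natAbs ∣ 216 * W.conductorNorm ℤ := by
  obtain ⟨θ, hθ⟩ := hθ
  have hint : IsIntegral ℚ θ := IsIntegral.of_finite ℚ θ
  have hdvd : minpoly ℚ θ ∣ W.twoTorsionPolynomial.toPoly := minpoly.dvd ℚ θ hθ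
  have hassoc := (minpoly.irreducible hint).associated_of_dvd hirr hdvd
  have hdeg : (minpoly ℚ θ).natDegree = 3 := by
    rw [Polynomial.natDegree_eq_of_degree_eq (Polynomial.degree_eq_degree_of_associated hassoc)]
    exact Cubic.natDegree_of_a_ne_zero (by norm_num [WeierstrassCurve.twoTorsionPolynomial])
  have hgen : IntermediateField.adjoin ℚ {θ} = ⊤ :=
    (Field.primitive_element_iff_minpoly_natDegree_eq ℚ θ).mpr (by rw [hdeg, hK])
  obtain ⟨ψ⟩ := exists_ringHom_divisionField_two W K hθ hgen
  exact natAbs_discr_dvd_216_mul_conductorNorm W K hK ψ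

/-- **H4 (S).** Real form: `|d_K| ≤ 216·N` on the stub's class. -/
theorem abs_discr_le_216_mul_conductorNorm (W : WeierstrassCurve ℚ) [W.IsElliptic]
    (K : Type*) [Field K] [NumberField K] (hirr : Irreducible W.twoTorsionPolynomial.toPoly)
    (hK : Module.finrank ℚ K = 3) (hθ : ∃ θ : K, aeval θ W.twoTorsionPolynomial.toPoly = 0) :
    |(NumberField.discr K : ℝ)| ≤ 216 * (W.conductorNorm ℤ : ℝ) := by
  have hN0 : W.conductorNorm ℤ ≠ 0 := (W.conductorNorm_pos_holds).ne'
  have h := abs_discr_le_of_natAbs_dvd K (M := 216 * W.conductorNorm ℤ) (by positivity)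
    (natAbs_discr_dvd_216_mul_conductorNorm_of_root W K hirr hK hθ)
  exact_mod_cast h

/-! ## H5 (S, bookkeeping, PROVED modulo H3) — the class-Szpiro window `6+ε ⇐ stub ⇐ 7+ε` -/

/-- `ClassSzpiroReal 6 → stub` (`|d_K| ≥ 1`). PROVED. -/
theorem stubRealCubic_of_classSzpiroReal_six (h : ClassSzpiroReal 6) : StubRealCubic := by
  intro ε hε
  obtain ⟨C, hC⟩ := h ε hε
  refine ⟨max C 0, ?_⟩
  intro W _ K _ _ hirr hK hθ hd
  have h1 := hC W K hirr hK hθ hd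
  have hN0 : (0 : ℝ) ≤ (W.conductorNorm ℤ : ℝ) ^ (6 + ε) := Real.rpow_nonneg (Nat.cast_nonneg _) _
  have hd1 : (1 : ℝ) ≤ |(NumberField.discr K : ℝ)| := by
    have : (1 : ℤ) ≤ |NumberField.discr K| := Int.one_le_abs (NumberField.discr_ne_zero K)
    have h' : ((1 : ℤ) : ℝ) ≤ ((|NumberField.discr K| : ℤ) : ℝ) := by exact_mod_cast this
    simpa [Int.cast_abs] using h'
  have hmax0 : (0 : ℝ) ≤ max C 0 := le_max_right _ _
  calc (W.minimalDiscriminantNorm ℤ : ℝ) ≤ C * (W.conductorNorm ℤ : ℝ) ^ (6 + ε) := h1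
    _ ≤ max C 0 * (W.conductorNorm ℤ : ℝ) ^ (6 + ε) := mul_le_mul_of_nonneg_right (le_max_left _ _) hN0
    _ = max C 0 * 1 * (W.conductorNorm ℤ : ℝ) ^ (6 + ε) := by rw [mul_one]
    _ ≤ max C 0 * |(NumberField.discr K : ℝ)| * (W.conductorNorm ℤ : ℝ) ^ (6 + ε) :=
        mul_le_mul_of_nonneg_right (mul_le_mul_of_nonneg_left hd1 hmax0) hN0

/-- `stub → ClassSzpiroReal 7`, from the allowance bound H4 (`|d_K| ≤ 216 N`, `N^{6+ε}·N = N^{7+ε}`).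
PROVED modulo H3. -/
theorem classSzpiroReal_seven_of_stubRealCubic (h : StubRealCubic) : ClassSzpiroReal 7 := by
  intro ε hε
  obtain ⟨C, hC⟩ := h ε hε
  refine ⟨216 * max C 0, ?_⟩
  intro W _ K _ _ hirr hK hθ hd
  have h1 := hC W K hirr hK hθ hd
  have hA := abs_discr_le_216_mul_conductorNorm W K hirr hK hθ
  have hNpos : (0 : ℝ) < (W.conductorNorm ℤ : ℝ) := by exact_mod_cast W.conductorNorm_pos_holds
  have hN0 : (0 : ℝ) ≤ (W.conductorNorm ℤ : ℝ) ^ (6 + ε) := Real.rpow_nonneg hNpos.le _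
  have hmax0 : (0 : ℝ) ≤ max C 0 := le_max_right _ _
  have hd0 : (0 : ℝ) ≤ |(NumberField.discr K : ℝ)| := abs_nonneg _
  have hsplit : (W.conductorNorm ℤ : ℝ) ^ (7 + ε) = (W.conductorNorm ℤ : ℝ) ^ (6 + ε) * (W.conductorNorm ℤ : ℝ) := by
    rw [show (7 : ℝ) + ε = (6 + ε) + 1 by ring, Real.rpow_add_one hNpos.ne']
  calc (W.minimalDiscriminantNorm ℤ : ℝ) ≤ C * |(NumberField.discr K : ℝ)| * (W.conductorNorm ℤ : ℝ) ^ (6 + ε) := h1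
    _ ≤ max C 0 * |(NumberField.discr K : ℝ)| * (W.conductorNorm ℤ : ℝ) ^ (6 + ε) :=
        mul_le_mul_of_nonneg_right (mul_le_mul_of_nonneg_right (le_max_left _ _) hd0) hN0
    _ ≤ max C 0 * (216 * (W.conductorNorm ℤ : ℝ)) * (W.conductorNorm ℤ : ℝ) ^ (6 + ε) :=
        mul_le_mul_of_nonneg_right (mul_le_mul_of_nonneg_left hA hmax0) hN0
    _ = 216 * max C 0 * (W.conductorNorm ℤ : ℝ) ^ (7 + ε) := by rw [hsplit]; ring

/-! ## H6 (S, given H1+H2 and the keystone) — EXACT allowance at odd multiplicative primes -/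

/-- **Keystone parity** (k1 G5 `K4_index_sq_int`/`K6_Δ_eq_sq_mul_discr`, PROVED in
`Cruxes/IndexSzpiro/StubIdeas1G5Sketch.lean`, restated on `|Δ_min|`): `2⁸·Δ_min = I²·d_K`, so the
exponents of `|Δ_min|` and `|d_K|` agree mod 2 at EVERY prime. Size S (port K4/K6 + `factorization` algebra). -/
theorem factorization_minimalDiscriminantNorm_mod_two_eq (W : WeierstrassCurve ℚ) [W.IsElliptic]
    (K : Type*) [Field K] [NumberField K] (hirr : Irreducible W.twoTorsionPolynomial.toPoly)
    (hK : Module.finrank ℚ K = 3) (hθ : ∃ θ : K, aeval θ W.twoTorsionPolynomial.toPoly = 0)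
    {p : ℕ} (hp : p.Prime) :
    (W.minimalDiscriminantNorm ℤ).factorization p % 2 = padicValNat p (NumberField.discr K).natAbs % 2 := by
  sorry

/-- **H6.** At an odd prime `p` with `f_p(E) = 1`: `v_p(d_K) = n_p mod 2` (`≤ 1` by H1+H2, parity by the
keystone).  This is the EXACT per-prime allowance: one factor `p` iff the Tate parameter has odd valuation.
PROVED modulo H1, H2 and the keystone. [cite: SilvermanATAEC1994, V.4–V.5 and Exercise 5.13 (b)] -/
theorem padicValNat_discr_eq_of_factorization_conductorNorm_eq_one (W : WeierstrassCurve ℚ) [W.IsElliptic]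
    (K : Type*) [Field K] [NumberField K] (hirr : Irreducible W.twoTorsionPolynomial.toPoly)
    (hK : Module.finrank ℚ K = 3) (hθ : ∃ θ : K, aeval θ W.twoTorsionPolynomial.toPoly = 0)
    (ψ : K →+* W.divisionField 2) {p : ℕ} (hp : p.Prime) (hp2 : p ≠ 2)
    (hf : (W.conductorNorm ℤ).factorization p = 1) :
    padicValNat p (NumberField.discr K).natAbs = (W.minimalDiscriminantNorm ℤ).factorization p % 2 := by
  have h1 := padicValNat_discr_le_one_of_ramificationIdx_le_two K hK hp hp2
    (ramificationIdx_le_two_of_factorization_conductorNorm_eq_one W K ψ hp hp2 hf)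
  have h2 := factorization_minimalDiscriminantNorm_mod_two_eq W K hirr hK hθ hp
  omega

/-! ## H7 (L — state only, do NOT staff; certified numerically by kit job j344906) — the true extreme `|d_K| ≤ 4·N` -/

/-- **H7a (conjectural-sharp, true by Swan-conductor comparison at 3 + `E[2]/ℤ₂` finite flat at 2; neither
is in the tree).** `|d_K| ∣ 8·N`. Census j344906: 0 violations. [cite: Serre1972, §5] -/
def NatAbsDiscrDvdEightMulConductor : Prop :=
  ∀ (W : WeierstrassCurve ℚ) [W.IsElliptic] (K : Type) [Field K] [NumberField K],
    Irreducible W.twoTorsionPolynomial.toPoly → Module.finrank ℚ K = 3 →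
    (∃ θ : K, aeval θ W.twoTorsionPolynomial.toPoly = 0) → (NumberField.discr K).natAbs ∣ 8 * W.conductorNorm ℤ

/-- **H7b (conjectural-sharp; the EXTREME OF THE ALLOWANCE).** `|d_K| ≤ 4·N`, with equality infinitely
often in the census (e.g. `[0,-1,1,-3,-1]`, `N = 933 = 3·311`, `d_K = 3732`; `N = 238201` prime,
`d_K = -4N`).  Census j344906: 0 violations; `v₂(d_K) ≤ f₂ + 2`, `v₃(d_K) ≤ f₃` (`= f₃` when `f₃ ≥ 3`),
`v_p(d_K) = κ ∈ {0,1,2}` by Kodaira type at additive `p ≥ 5` (`II,IV,IV*,II* ↦ 2`, `III,III* ↦ 1`, `I₀* ↦ 0`). -/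
def AbsDiscrLeFourMulConductor : Prop :=
  ∀ (W : WeierstrassCurve ℚ) [W.IsElliptic] (K : Type) [Field K] [NumberField K],
    Irreducible W.twoTorsionPolynomial.toPoly → Module.finrank ℚ K = 3 →
    (∃ θ : K, aeval θ W.twoTorsionPolynomial.toPoly = 0) → (NumberField.discr K).natAbs ≤ 4 * W.conductorNorm ℤ

/-! ## Assembly sketch.  Helpers ⇒ window, NOT ⇒ stub.  `StubRealCubic` itself ⇔ (on its class) k2 g4's
`OddTowerSzpiro` up to the additive factor `∏_{p add} p^{κ_p} ≤ N_add` (H6 makes k2 g4's "implied back up to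
`N_add`" exact); `OddTowerSzpiro` is Szpiro-strength (OPEN).  Nothing below the window is claimed. -/

/-- The window, assembled: `ClassSzpiroReal 6 → StubRealCubic` and `StubRealCubic → ClassSzpiroReal 7`. -/
theorem window : (ClassSzpiroReal 6 → StubRealCubic) ∧ (StubRealCubic → ClassSzpiroReal 7) :=
  ⟨stubRealCubic_of_classSzpiroReal_six, classSzpiroReal_seven_of_stubRealCubic⟩

end Summit.ABC.ABC.Cruxes.IndexSzpiro.StubIdeas3G8

end
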